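import Mathlib

/-! # Ki–Kim (3.1) / de Gua–Pólya–Hurwitz — the real-variable COROLLARY, PROVED (C4 rh-idea-6 g27; statement = C1 rh-idea-5 g24 WORDS-62)

Source of the statement [corpus: paper:doi-10-1215-s0012-7094-00-10413-9 = Ki–Kim, Duke Math. J. 104 (2000)]: p.46 eq. (1.1)
(critical zeros), p.46 ll.41–44 (de Gua's rule, from Pólya, Quart. J. Math. Oxford (2) 1 (1930) 21–34, pp. 21–23, and
Hurwitz, Math. Ann. 71 (1912) 584–591, pp. 589–590), p.54 eq. (3.1) (Hurwitz pp. 585–587):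
`2·K_[a,b](f^{(λ)}) = N_[a,b](f^{(λ)}) − N_[a,b](f^{(λ−1)}) − ½[sg(f^{(λ−1)}(a)f^{(λ)}(a)) − sg(f^{(λ−1)}(b)f^{(λ)}(b))]`.

The first block (`LawEvent`, `SimpleCriticalZero`, the two dictionary lemmas, `KiKim31Corollary`) is C1's typed text
VERBATIM (`kikim31-sketch-W08-C1-rh-idea-5-g24.lean` 2e2606f3c4d5b9f2). The second block PROVES `KiKim31Corollary` without any
sign-table bookkeeping:

* PIGEONHOLE. Send each zero `c` of `g'` in `[a,b]` to `#{zeros of g in [a,b] below c} ∈ {0,…,N}`. With `N' ≥ N + 2 > N + 1`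
  zeros of `g'`, two of them `c < c'` receive the same count, so `g` has NO zero in `[c, c']` (zeros of `g` are simple, hence
  `g c ≠ 0 ≠ g c'`). Let `c₂` be the least zero of `g'` in `(c, c']`: then `c₁ := c < c₂` are CONSECUTIVE zeros of `g'`.
* ALTERNATION (`deriv_mul_deriv_neg_of_consecutive_zeros`). At consecutive simple zeros of `ψ := g'` the derivative alternates:
  `ψ'(c₁)·ψ'(c₂) < 0` — the one-sided slope limits of `HasDerivAt` give the sign of `ψ` just right of `c₁` and just left of
  `c₂`, and `ψ` has constant sign on `(c₁, c₂)` by the intermediate value theorem.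
* SIGN. `g` has no zero on `[c₁, c₂]`, so `g(c₁)·g(c₂) > 0` (IVT). Hence `(g·g'')(c₁)·(g·g'')(c₂) < 0` and one of the two
  consecutive zeros is the wanted critical zero `g' c = 0 ∧ 0 < g c·g'' c`; it is interior because `g' a ≠ 0 ≠ g' b`.

(The hypothesis `Continuous g''` of the typed statement is not used.) Helper material for the EXISTENCE clause of the W-08
law-421 programme (`stmt-RiemannHypothesis-24774`); it is elementary real analysis and says nothing about ζ. Typed and proved ≠ RH;
RH is not proved. -/

open Set Filter Topology

namespace RhW08.KiKim

/-- LAW 421's event for a derivative ladder `F : ℕ → ℝ → ℝ` (think `F k x = (iteratedDeriv k f (x:ℂ)).re`) at level `k`, abscissa `x`. -/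
def LawEvent (F : ℕ → ℝ → ℝ) (k : ℕ) (x : ℝ) : Prop :=
  F (k + 1) x = 0 ∧ F k x ≠ 0 ∧ 0 ≤ F k x * F (k + 2) x

/-- Ki–Kim (1.1) with `m = 1`: a SIMPLE critical zero of `F l` at `c` (`l ≥ 1`): `F l c = 0`, `F (l+1) c ≠ 0`, `F (l-1) c * F (l+1) c > 0`. -/
def SimpleCriticalZero (F : ℕ → ℝ → ℝ) (l : ℕ) (c : ℝ) : Prop :=
  F l c = 0 ∧ F (l + 1) c ≠ 0 ∧ 0 < F (l - 1) c * F (l + 1) c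

/-- (K, dictionary) a simple critical zero of `F (k+1)` is a LAW event at level `k`. -/
theorem lawEvent_of_simpleCritical {F : ℕ → ℝ → ℝ} {k : ℕ} {c : ℝ} (h : SimpleCriticalZero F (k + 1) c) : LawEvent F k c := by
  obtain ⟨h0, -, hpos⟩ := h
  refine ⟨h0, ?_, ?_⟩
  · intro hk
    simp [hk] at hpos
  · simpa using hpos.le

/-- (K, dictionary) a LAW event at level `k` with `F (k+2) c ≠ 0` is a simple critical zero of `F (k+1)`; with `F (k+2) c = 0` it is a multiple zero of
`F (k+1)` (critical by (1.1), `m ≥ 2`). -/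
theorem simpleCritical_or_multiple_of_lawEvent {F : ℕ → ℝ → ℝ} {k : ℕ} {c : ℝ} (h : LawEvent F k c) :
    SimpleCriticalZero F (k + 1) c ∨ (F (k + 1) c = 0 ∧ F (k + 2) c = 0) := by
  obtain ⟨h0, hk, hprod⟩ := h
  by_cases h2 : F (k + 2) c = 0
  · exact Or.inr ⟨h0, h2⟩
  · refine Or.inl ⟨h0, h2, ?_⟩
    rcases hprod.lt_or_eq with hlt | heq
    · simpa using hlt
    · exact absurd heq.symm (mul_ne_zero hk h2)

/-- ★ TYPED COROLLARY of Ki–Kim (3.1) («two extra real zeros ⇒ a critical zero»), generic multiplicity-free form: `g = F (l-1)`, `g' = F l`, `g'' = F (l+1)` on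
`[a, b]` with `g' = deriv g`, `g'' = deriv g'` there, all zeros of `g` and `g'` in `[a,b]` simple and off the endpoints; if `g'` has at least TWO MORE zeros in
`[a,b]` than `g`, then `g'` has a simple critical zero in `(a,b)`: `∃ c, g' c = 0 ∧ 0 < g c * g'' c`. (Rolle places ≥ N−1 zeros of `g'` between zeros of `g`
with `g·g'' < 0`-free sign pattern; the sign bookkeeping of [H2 pp. 585–587] forces one of the surplus zeros to have `g·g'' > 0`.) -/
def KiKim31Corollary : Prop :=
  ∀ (g g' g'' : ℝ → ℝ) (a b : ℝ), a < b →
    (∀ x ∈ Set.Icc a b, HasDerivAt g (g' x) x) → (∀ x ∈ Set.Icc a b, HasDerivAt g' (g'' x) x) → Continuous g'' →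
    g a ≠ 0 → g b ≠ 0 → g' a ≠ 0 → g' b ≠ 0 →
    (∀ x ∈ Set.Icc a b, g x = 0 → g' x ≠ 0) → (∀ x ∈ Set.Icc a b, g' x = 0 → g'' x ≠ 0) →
    ({x ∈ Set.Icc a b | g x = 0}.Finite) → ({x ∈ Set.Icc a b | g' x = 0}.Finite) →
    {x ∈ Set.Icc a b | g x = 0}.ncard + 2 ≤ {x ∈ Set.Icc a b | g' x = 0}.ncard →
    ∃ c ∈ Set.Ioo a b, g' c = 0 ∧ 0 < g c * g'' c

/-! ## The proof (C4 g27) -/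

/-! ### Local sign of a function next to a simple zero (one-sided slope limits) -/

/-- `φ c = 0`, `φ' (c) = d > 0` ⇒ `φ > 0` immediately to the RIGHT of `c`. -/
theorem eventually_pos_right_of_hasDerivAt {φ : ℝ → ℝ} {d c : ℝ} (h : HasDerivAt φ d c) (h0 : φ c = 0)
    (hd : 0 < d) : ∀ᶠ y in 𝓝[>] c, 0 < φ y := by
  have hev : ∀ᶠ y in 𝓝[≠] c, 0 < slope φ c y :=
    (hasDerivAt_iff_tendsto_slope.1 h).eventually (lt_mem_nhds hd)
  have hev' : ∀ᶠ y in 𝓝[>] c, 0 < slope φ c y := hev.filter_mono (nhdsGT_le_nhdsNE c)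
  filter_upwards [hev', self_mem_nhdsWithin] with y hy hyc
  rw [slope_def_field, h0, sub_zero] at hy
  exact (div_pos_iff_of_pos_right (sub_pos.2 hyc)).1 hy

/-- `φ c = 0`, `φ' (c) = d > 0` ⇒ `φ < 0` immediately to the LEFT of `c`. -/
theorem eventually_neg_left_of_hasDerivAt {φ : ℝ → ℝ} {d c : ℝ} (h : HasDerivAt φ d c) (h0 : φ c = 0)
    (hd : 0 < d) : ∀ᶠ y in 𝓝[<] c, φ y < 0 := by
  have hev : ∀ᶠ y in 𝓝[≠] c, 0 < slope φ c y :=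
    (hasDerivAt_iff_tendsto_slope.1 h).eventually (lt_mem_nhds hd)
  have hev' : ∀ᶠ y in 𝓝[<] c, 0 < slope φ c y := hev.filter_mono (nhdsLT_le_nhdsNE c)
  filter_upwards [hev', self_mem_nhdsWithin] with y hy hyc
  rw [slope_def_field, h0, sub_zero] at hy
  have hyc' : y - c < 0 := sub_neg.2 hyc
  have hne : y - c ≠ 0 := hyc'.ne
  have hmul : φ y / (y - c) * (y - c) < 0 := mul_neg_of_pos_of_neg hy hyc'
  rwa [div_mul_cancel₀ _ hne] at hmul

/-! ### Alternation at consecutive simple zeros -/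

/-- If `c₁ < c₂` are consecutive zeros of a continuous `ψ` (`ψ ≠ 0` on `(c₁, c₂)`), differentiable at both, and
`ψ'(c₁) = d₁ > 0`, then `ψ'(c₂) = d₂ ≤ 0`. -/
theorem deriv_nonpos_at_next_zero {ψ : ℝ → ℝ} {d₁ d₂ c₁ c₂ : ℝ} (hlt : c₁ < c₂)
    (hcont : ContinuousOn ψ (Icc c₁ c₂)) (h₁ : HasDerivAt ψ d₁ c₁) (h₂ : HasDerivAt ψ d₂ c₂)
    (hz₁ : ψ c₁ = 0) (hz₂ : ψ c₂ = 0) (hnz : ∀ y ∈ Ioo c₁ c₂, ψ y ≠ 0) (hd₁ : 0 < d₁) : d₂ ≤ 0 := by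
  by_contra hd₂
  have hd₂' : 0 < d₂ := lt_of_not_ge hd₂
  -- a point right of `c₁` with `ψ > 0`
  obtain ⟨y₀, hy₀pos, hy₀⟩ := ((eventually_pos_right_of_hasDerivAt h₁ hz₁ hd₁).and
    (Filter.eventually_mem_set.2 (Ioo_mem_nhdsGT hlt))).exists
  -- a point left of `c₂` with `ψ < 0`
  obtain ⟨y₁, hy₁neg, hy₁⟩ := ((eventually_neg_left_of_hasDerivAt h₂ hz₂ hd₂').and
    (Filter.eventually_mem_set.2 (Ioo_mem_nhdsLT hlt))).exists
  -- IVT between `y₀` and `y₁`, inside `(c₁, c₂)`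
  have hsubI : uIcc y₀ y₁ ⊆ Ioo c₁ c₂ := ordConnected_Ioo.uIcc_subset hy₀ hy₁
  have h0mem : (0 : ℝ) ∈ uIcc (ψ y₀) (ψ y₁) := Set.mem_uIcc.2 (Or.inr ⟨hy₁neg.le, hy₀pos.le⟩)
  obtain ⟨x, hx, hx0⟩ := intermediate_value_uIcc (hcont.mono (hsubI.trans Ioo_subset_Icc_self)) h0mem
  exact hnz x (hsubI hx) hx0

/-- ALTERNATION: at CONSECUTIVE SIMPLE zeros `c₁ < c₂` of a continuous `ψ` (think `ψ = g'`), the derivative values have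
opposite signs: `ψ'(c₁)·ψ'(c₂) < 0`. -/
theorem deriv_mul_deriv_neg_of_consecutive_zeros {ψ : ℝ → ℝ} {d₁ d₂ c₁ c₂ : ℝ} (hlt : c₁ < c₂)
    (hcont : ContinuousOn ψ (Icc c₁ c₂)) (h₁ : HasDerivAt ψ d₁ c₁) (h₂ : HasDerivAt ψ d₂ c₂)
    (hz₁ : ψ c₁ = 0) (hz₂ : ψ c₂ = 0) (hne₁ : d₁ ≠ 0) (hne₂ : d₂ ≠ 0)
    (hnz : ∀ y ∈ Ioo c₁ c₂, ψ y ≠ 0) : d₁ * d₂ < 0 := by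
  rcases lt_or_gt_of_ne hne₁ with hneg | hpos
  · -- `d₁ < 0`: apply the previous lemma to `-ψ`
    have hcont' : ContinuousOn (fun y => -ψ y) (Icc c₁ c₂) := hcont.neg
    have h := deriv_nonpos_at_next_zero hlt hcont' h₁.neg h₂.neg (by simp [hz₁]) (by simp [hz₂])
      (fun y hy => neg_ne_zero.2 (hnz y hy)) (neg_pos.2 hneg)
    have hd₂ : 0 < d₂ := lt_of_le_of_ne (neg_nonpos.1 h) hne₂.symm
    exact mul_neg_of_neg_of_pos hneg hd₂
  · have h := deriv_nonpos_at_next_zero hlt hcont h₁ h₂ hz₁ hz₂ hnz hpos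
    have hd₂ : d₂ < 0 := lt_of_le_of_ne h hne₂
    exact mul_neg_of_pos_of_neg hpos hd₂

/-- A continuous function with no zero on `[c₁, c₂]` has the same sign at the two endpoints. -/
theorem mul_pos_of_forall_ne_zero {g : ℝ → ℝ} {c₁ c₂ : ℝ} (hle : c₁ ≤ c₂) (hcont : ContinuousOn g (Icc c₁ c₂))
    (hnz : ∀ x ∈ Icc c₁ c₂, g x ≠ 0) : 0 < g c₁ * g c₂ := by
  rcases lt_or_gt_of_ne (hnz c₁ (left_mem_Icc.2 hle)) with h1 | h1 <;>
    rcases lt_or_gt_of_ne (hnz c₂ (right_mem_Icc.2 hle)) with h2 | h2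
  · exact mul_pos_of_neg_of_neg h1 h2
  · exfalso
    obtain ⟨x, hx, hx0⟩ := intermediate_value_Icc hle hcont ⟨h1.le, h2.le⟩
    exact hnz x hx hx0
  · exfalso
    obtain ⟨x, hx, hx0⟩ := intermediate_value_Icc' hle hcont ⟨h2.le, h1.le⟩
    exact hnz x hx hx0
  · exact mul_pos h1 h2

/-! ### The corollary -/

/-- ★★★ Ki–Kim (3.1) corollary, PROVED: two surplus zeros of `g'` over `g` in `[a,b]` force a simple critical zero of `g'`
(`g' c = 0`, `g c · g'' c > 0`) in `(a,b)`. -/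
theorem kiKim31Corollary : KiKim31Corollary := by
  intro g g' g'' a b hab hg hg' _hg''c _hga _hgb hg'a hg'b hsimp hsimp' hZfin hZ'fin hcard
  -- continuity of `g` and `g'` on `[a, b]`
  have hgc : ContinuousOn g (Icc a b) := fun x hx => (hg x hx).continuousAt.continuousWithinAt
  have hg'c : ContinuousOn g' (Icc a b) := fun x hx => (hg' x hx).continuousAt.continuousWithinAt
  set Z : Set ℝ := {x ∈ Set.Icc a b | g x = 0} with hZ
  set Z' : Set ℝ := {x ∈ Set.Icc a b | g' x = 0} with hZ'
  -- PIGEONHOLE on the counting map `φ c = #{zeros of g below c}`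
  set N := Z.ncard with hN
  have hφ : ∀ c : ℝ, (Z ∩ Iio c).ncard ≤ N := fun c => Set.ncard_le_ncard Set.inter_subset_left hZfin
  have hmaps : ∀ c ∈ hZ'fin.toFinset, (fun c => (Z ∩ Iio c).ncard) c ∈ Finset.range (N + 1) :=
    fun c _ => Finset.mem_range.2 (Nat.lt_succ_of_le (hφ c))
  have hlt : (Finset.range (N + 1)).card < hZ'fin.toFinset.card := by
    rw [Finset.card_range, ← Set.ncard_eq_toFinset_card Z' hZ'fin]
    omega
  obtain ⟨c, hc, c', hc', hcc', hφcc'⟩ := Finset.exists_ne_map_eq_of_card_lt_of_maps_to hlt hmaps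
  rw [Set.Finite.mem_toFinset] at hc hc'
  -- w.l.o.g. `c < c'`
  wlog hlt' : c < c' generalizing c c'
  · exact this c' hc' c hc hcc'.symm hφcc'.symm (lt_of_le_of_ne (not_lt.1 hlt') hcc'.symm)
  -- `c, c'` are zeros of `g'` in `[a,b]`, hence not zeros of `g`
  have hgc0 : g c ≠ 0 := fun h0 => hsimp c hc.1 h0 hc.2
  have hgc'0 : g c' ≠ 0 := fun h0 => hsimp c' hc'.1 h0 hc'.2
  -- no zero of `g` in `[c, c']`
  have hnoZ : ∀ x ∈ Icc c c', g x ≠ 0 := by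
    intro x hx hx0
    have hxab : x ∈ Icc a b := ⟨hc.1.1.trans hx.1, hx.2.trans hc'.1.2⟩
    have hxc : c < x := lt_of_le_of_ne hx.1 (by rintro rfl; exact hgc0 hx0)
    have hxc' : x < c' := lt_of_le_of_ne hx.2 (by rintro rfl; exact hgc'0 hx0)
    have hss : Z ∩ Iio c ⊂ Z ∩ Iio c' := by
      refine ⟨fun y hy => ⟨hy.1, lt_trans hy.2 hlt'⟩, fun hsub => ?_⟩
      have hmem : x ∈ Z ∩ Iio c := hsub ⟨⟨hxab, hx0⟩, hxc'⟩
      exact absurd hmem.2 (not_lt.2 hxc.le)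
    have hlt2 := Set.ncard_lt_ncard hss (hZfin.subset Set.inter_subset_left)
    exact absurd hφcc' (ne_of_lt hlt2)
  -- `c₂` := the least zero of `g'` in `(c, c']`; then `c < c₂` are consecutive zeros of `g'`
  obtain ⟨c₂, ⟨hc₂Z', hc₂I⟩, hmin⟩ := Set.exists_min_image (Z' ∩ Ioc c c') id
    (hZ'fin.subset Set.inter_subset_left) ⟨c', hc', hlt', le_rfl⟩
  have hmin' : ∀ x ∈ Z' ∩ Ioc c c', c₂ ≤ x := fun x hx => hmin x hx
  have hnz' : ∀ y ∈ Ioo c c₂, g' y ≠ 0 := by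
    intro y hy hy0
    have hyab : y ∈ Icc a b := ⟨hc.1.1.trans hy.1.le, (hy.2.le.trans hc₂I.2).trans hc'.1.2⟩
    have hle := hmin' y ⟨⟨hyab, hy0⟩, hy.1, hy.2.le.trans hc₂I.2⟩
    exact absurd hy.2 (not_lt.2 hle)
  have hsubab : Icc c c₂ ⊆ Icc a b := Icc_subset_Icc hc.1.1 hc₂Z'.1.2
  have hnoZ₂ : ∀ x ∈ Icc c c₂, g x ≠ 0 := fun x hx => hnoZ x ⟨hx.1, hx.2.trans hc₂I.2⟩
  -- ALTERNATION at the consecutive pair and SIGN of `g`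
  have halt : g'' c * g'' c₂ < 0 :=
    deriv_mul_deriv_neg_of_consecutive_zeros hc₂I.1 (hg'c.mono hsubab) (hg' c hc.1) (hg' c₂ hc₂Z'.1)
      hc.2 hc₂Z'.2 (hsimp' c hc.1 hc.2) (hsimp' c₂ hc₂Z'.1 hc₂Z'.2) hnz'
  have hsg : 0 < g c * g c₂ := mul_pos_of_forall_ne_zero hc₂I.1.le (hgc.mono hsubab) hnoZ₂
  have hprod : (g c * g'' c) * (g c₂ * g'' c₂) < 0 := by
    have heq : (g c * g'' c) * (g c₂ * g'' c₂) = (g c * g c₂) * (g'' c * g'' c₂) := by ring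
    rw [heq]
    exact mul_neg_of_pos_of_neg hsg halt
  -- both candidate points are interior
  have hcI : c ∈ Ioo a b :=
    ⟨lt_of_le_of_ne hc.1.1 (by rintro rfl; exact hg'a hc.2), lt_of_le_of_ne hc.1.2 (by rintro rfl; exact hg'b hc.2)⟩
  have hc₂I' : c₂ ∈ Ioo a b :=
    ⟨hcI.1.trans hc₂I.1, lt_of_le_of_ne hc₂Z'.1.2 (by rintro rfl; exact hg'b hc₂Z'.2)⟩
  by_cases h1 : 0 < g c * g'' c
  · exact ⟨c, hcI, hc.2, h1⟩
  · refine ⟨c₂, hc₂I', hc₂Z'.2, ?_⟩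
    have h1' : g c * g'' c ≤ 0 := not_lt.1 h1
    by_contra h2
    have h2' : g c₂ * g'' c₂ ≤ 0 := not_lt.1 h2
    have h3 : 0 ≤ (g c * g'' c) * (g c₂ * g'' c₂) := mul_nonneg_of_nonpos_of_nonpos h1' h2'
    exact absurd hprod (not_lt.2 h3)

/-- sanity instance of the DICTIONARY on LAW 421's own numerals: `F 0 = g = x² − 1 + 3 = x² + 2 > 0`, `F 1 = 2x`, `F 2 = 2`: the zero `x = 0` of `F 1` has
`F 0 · F 2 = 4 > 0` — a simple critical zero, hence a LAW event at level 0. -/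
example : LawEvent (fun k x => if k = 0 then x ^ 2 + 2 else if k = 1 then 2 * x else if k = 2 then 2 else 0) 0 0 :=
  lawEvent_of_simpleCritical ⟨by simp, by simp, by norm_num⟩

end RhW08.KiKim
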